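import Literature.Algebra.Homology.GroupCohomologyNilpotentCoresolution
import Literature.Algebra.Homology.GroupCohomologyInvariantsNilpotent
import HarnessLib

/-!
# Hochschild–Serre nilpotence: operators killing `H•(Γ, W)` act nilpotently on `H^q(Γ, W^H)`

Topic `Algebra/Homology`; namespace `Literature.Algebra.Homology`.  A *proofs* file (theorems
only) assembling `GroupCohomologyNilpotentCoresolution` (nilpotence propagation along a
coresolution, by dimension shifting) and `GroupCohomologyInvariantsNilpotent` (the `H`-cochain
coresolution `0 → W^H → C⁰(H, W) → C¹(H, W) → ⋯` of a representation `W` of `Γ × H`, its short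
exact pieces under `H`-acyclicity, and the pointwise vanishing lemma for `Fun(S, A)`):

* `pow_succ_map_hKerRep_zero_eq_zero`: if `Hᶜ(H, W|_H) = 0` for all `c ≥ 1` and the endomorphism
  `φ` of `W` induces `0` on `Hᵇ(Γ, W|_Γ)` for all `b ≤ q`, then `H^q(Γ, φ)` on `H^q(Γ, W^H)`
  (`W^H = hKerRep W 0 = ker d⁰`, cf. `mem_hKer_zero_iff`) satisfies `H^q(Γ, φ)^(q+1) = 0`;
* `pow_succ_map_hKerRep_zero_eq_zero_of_free`: the same with the acyclicity hypothesis
  discharged for `W|_H ≅ Fun(S, N)` the twisted function representation of a FREE `H`-set `S`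
  (`isZero_groupCohomology_twistedPi_succ`), the situation of a Galois cover of levels
  `X_{L'} → X_L` with group `H = L/L'` acting freely on `𝒢/L'`.

This is the statement that [Scholze2015, §V.4, proof of Thm. V.4.1] extracts from the
Hochschild–Serre spectral sequence `Hᵃ(K/K', Hᵇ(X_{K'}, M/p^m)) ⇒ H^{a+b}(X_K, M/p^m)`
("This reduces us to the case that `K` is sufficiently small, and that `ξ` is trivial"): a Hecke
operator vanishing on all `Hᵇ(X_{K'}, M/p^m)`, `b ≤ q`, acts on `H^q(X_K, M/p^m)` with
`(q+1)`-st power zero [Emerton2006, §2.2].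

## References

* P. Scholze, *On torsion in the cohomology of locally symmetric varieties*, Ann. of Math. 182
  (2015), §V.4, proof of Thm. V.4.1 [Scholze2015].
* M. Emerton, *On the interpolation of systems of eigenvalues attached to automorphic Hecke
  eigenforms*, Invent. Math. 164 (2006), §2.2 [Emerton2006].
* K. S. Brown, *Cohomology of Groups*, GTM 87 (1982), III §7, VII §6 [Brown1982CohomologyGroups].
-/

noncomputable section

open CategoryTheory groupCohomology

universe u

namespace Literature.Algebra.Homology

variable {k : Type u} [CommRing k] {Γ H : Type u} [Group Γ] [Group H] (W : Rep.{u} k (Γ × H))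
  (φ : W ⟶ W)

/-- **Hochschild–Serre nilpotence.**  Let `W` be a representation of `Γ × H` whose restriction
to `H` is acyclic (`Hᶜ(H, W|_H) = 0` for `c ≥ 1`; e.g. `W` coinduced from the trivial subgroup of
`H`, by Shapiro's lemma), and `φ` an endomorphism of `W` such that `Hᵇ(Γ, φ|_Γ) = 0` on
`Hᵇ(Γ, W|_Γ)` for all `b ≤ q`.  Then `H^q(Γ, φ)` acts on `H^q(Γ, W^H)` — `W^H = ker d⁰` as a
`Γ`-representation, `hKerRep W 0`, see `mem_hKer_zero_iff` — with `(q+1)`-st power zero.  This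
is what [cite: Scholze2015, §V.4, proof of Thm. V.4.1] extracts from the Hochschild–Serre
spectral sequence `Hᵃ(H, Hᵇ(Γ, W)) ⇒ H^{a+b}(Γ, W^H)`; proved here by dimension shifting along
the `H`-cochain coresolution `0 → W^H → C⁰(H, W) → C¹(H, W) → ⋯`
(`pow_succ_map_eq_zero_of_coresolution_zero`, `hKer_shortExact`, `map_piConstHom_eq_zero`). -/
theorem pow_succ_map_hKerRep_zero_eq_zero (q : ℕ)
    (hacyc : ∀ c : ℕ, Limits.IsZero (groupCohomology (resSnd W) (c + 1)))
    (hφ : ∀ b ≤ q,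
      groupCohomology.map (A := resFst W) (MonoidHom.id Γ) (resFstMap W φ) b = 0) :
    (groupCohomology.map (A := hKerRep W 0) (MonoidHom.id Γ) (φZ W φ 0) q).hom ^ (q + 1) = 0 :=
  pow_succ_map_eq_zero_of_coresolution_zero (hKerRep W) (hCochainsRep W) (hι W) (hπ W)
    (hι_hπ W) (fun a => hKer_shortExact W a (hacyc a)) (φZ W φ) (φC W φ) (φZ_hι W φ)
    (φC_hπ W φ) q fun a b hab =>
      map_piConstHom_eq_zero (Fin a → H) (resFst W) (resFstMap W φ) b (hφ b (by omega))


/-- **Hochschild–Serre nilpotence for a free `H`-set.**  Let `S` be a FREE `H`-set, `N` a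
representation of `H`, and `W` a representation of `Γ × H` whose restriction to `H` is
isomorphic to the twisted function representation `Fun(S, N)` (`twistedPi S N`,
`(h f)(s) = ρ_N(h) f(h⁻¹ s)`).  If the endomorphism `φ` of `W` induces `0` on `Hᵇ(Γ, W|_Γ)` for
all `b ≤ q`, then `H^q(Γ, φ)^(q+1) = 0` on `H^q(Γ, W^H)` (`W^H = hKerRep W 0`).
[cite: Scholze2015, §V.4, proof of Thm. V.4.1] -/
theorem pow_succ_map_hKerRep_zero_eq_zero_of_free {S : Type u} [MulAction H S]
    (hfree : ∀ (h : H) (s : S), h • s = s → h = 1) (N : Rep.{u} k H)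
    (e : resSnd W ≅ twistedPi S N) (q : ℕ)
    (hφ : ∀ b ≤ q,
      groupCohomology.map (A := resFst W) (MonoidHom.id Γ) (resFstMap W φ) b = 0) :
    (groupCohomology.map (A := hKerRep W 0) (MonoidHom.id Γ) (φZ W φ 0) q).hom ^ (q + 1) = 0 :=
  pow_succ_map_hKerRep_zero_eq_zero W φ q
    (fun c => (isZero_groupCohomology_twistedPi_succ S N hfree c).of_iso
      ((groupCohomology.functor k H (c + 1)).mapIso e)) hφ

end Literature.Algebra.Homology
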